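import Summits.ValiantsHypothesis.ValiantsHypothesis.Theorems.GrenetZeonDualUnipotentThreeHalvesLongMassNilSpaceTracePermutable
import Summits.ValiantsHypothesis.ValiantsHypothesis.Theorems.GrenetZeonDualUnipotentThreeHalvesLongMassPerPencilPrice
import Summits.ValiantsHypothesis.ValiantsHypothesis.Theorems.GrenetZeonTwoDimCoefficientsDualUnipotentEngelRung

/-!
# `GrenetZeon.TwoDimCoefficients` (stmt-ValiantsHypothesis-8062), stub `stub_dualUnipotent` — the PERMUTABLE-TRACE RUNG:
# `per_n = tr(N^{n−1} M)` over a nil value space whose generator commutators are trace-orthogonal to its envelope forces `m ≳ n^{3/2}/2`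

leafhand-val-grenetzeon-2 gen29 (30th hand), 2026-09-01; 8062-side twin of the (c)-row `…LongMassNilSpaceTracePermutable` (p843556).

The located open point of `stub_dualUnipotent : DualUnipotentBound` is the WILD (non-triangularisable) nilpotent pencil (`Lines/dim2_cases.lean`
docstring; triangularisable pencils give `m ≳ n^{3/2}/(2√2)` by ✓ `sq_le_of_trace_pow_mul_strictUpper'`, `m ≳ n^{3/2}/√2` through the per-pencil price
bridge ✓ `PerPencilPrice.le_of_relCert_of_perPoly_eq_trace`, `m ≳ n^{3/2}/2` with the constant-2 row).  This file states those rungs under the TEST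
form of triangularisability landed this hand (Radjavi's trace criterion, ✓ `TraceTriangularisable.conj_strictUpper_iff_commutator_traceOrth`):
the value space `V` of `N` is nil and `tr((AB − BA)u) = 0` for all `A, B ∈ V`, `u ∈ ℂ⟨V⟩` (equivalently: permutable trace on `ℂ⟨V⟩`).

* ★ `le_of_perPoly_eq_trace_commutator_traceOrth` — `per_n = tr(N^{n−1}M)`, `N`, `M` affine, values of `N` in such a `V` ⇒ `n(n−1) ≤ 2⌊√n⌋·m`.
* `le_of_perPoly_eq_trace_trace_permutable` — the same under permutable trace.
* `sq_le_of_trace_pow_mul_commutator_traceOrth` — the `(q, k)`-family form `n² ≤ 2kn + m·q` (✓ `DualUnipotentEngelRung.sq_le_of_trace_pow_mul_valueSpace_conj`),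
  any exponent `d`.
So a width-`o(n^{3/2})` dual-unipotent representation of `per_n` has a value space with a witness `tr((AB − BA)u) ≠ 0` — its envelope does NOT have
permutable trace (one more excluded species for 8062 by name; the wild core is untouched).

Honest framing.  Helper (`--supports stmt-ValiantsHypothesis-8062`); nothing here proves `DualUnipotentBound`, `TwoDimCoefficients`, 24318 or
`VP ≠ VNP` — OPEN / NOT proved.  Def-free, no sorry. [cite: RadjaviRosenthal2000, Thm. 2.2.1 (§2.2 Permutable Trace)]
-/

set_option linter.dupNamespace false
set_option autoImplicit false

noncomputable section

namespace Summit.ValiantsHypothesis.ValiantsHypothesis.Theorems.GrenetZeon.TraceTriangularisable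

open MvPolynomial Matrix
open scoped BigOperators
open Literature.Computability.AlgebraicComplexity (perPoly)
open Summit.ValiantsHypothesis.ValiantsHypothesis.Cruxes.TwoDimCoefficients.DimTwoCases (AffMat IsAffine)
open Summit.ValiantsHypothesis.ValiantsHypothesis.Theorems.GrenetZeon.SlowCore (RelCert)
open Summit.ValiantsHypothesis.ValiantsHypothesis.Theorems.GrenetZeon.PerPencilPrice (le_of_relCert_of_perPoly_eq_trace)
open Summit.ValiantsHypothesis.ValiantsHypothesis.Theorems.GrenetZeon.DualUnipotentEngelRung (sq_le_of_trace_pow_mul_valueSpace_conj)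

variable {n m : ℕ}

/-- ★ **PERMUTABLE-TRACE RUNG (floor form, constant 2).**  If `per_n = tr(N^{n−1}·M)` with affine `m × m` pencils and the values of `N` lie in a
nil space `V ≤ M_m(ℂ)` whose generator commutators are trace-orthogonal to the envelope `ℂ⟨V⟩`, then `n(n−1) ≤ 2⌊√n⌋·m`, i.e. `m ≳ n^{3/2}/2`.
[cite: RadjaviRosenthal2000, Thm. 2.2.1] -/
theorem le_of_perPoly_eq_trace_commutator_traceOrth (N M : AffMat n m) (hN : IsAffine N) (hM : IsAffine M)
    (hper : perPoly (Fin n) ℂ = (N ^ (n - 1) * M).trace)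
    (V : Submodule ℂ (Matrix (Fin m) (Fin m) ℂ)) (hV : ∀ x : Fin n × Fin n → ℂ, N.map (MvPolynomial.eval x) ∈ V)
    (hnil : ∀ A ∈ V, IsNilpotent A)
    (h : ∀ A ∈ V, ∀ B ∈ V, ∀ u ∈ Algebra.adjoin ℂ (V : Set (Matrix (Fin m) (Fin m) ℂ)), Matrix.trace ((A * B - B * A) * u) = 0) :
    n * (n - 1) ≤ 2 * (Nat.sqrt n * m) :=
  le_of_relCert_of_perPoly_eq_trace N M hM hper (relCert_of_valueSpace_commutator_traceOrth N hN V hV hnil h)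

/-- The same rung under PERMUTABLE TRACE on the envelope. [cite: RadjaviRosenthal2000, Thm. 2.2.1] -/
theorem le_of_perPoly_eq_trace_trace_permutable (N M : AffMat n m) (hN : IsAffine N) (hM : IsAffine M)
    (hper : perPoly (Fin n) ℂ = (N ^ (n - 1) * M).trace)
    (V : Submodule ℂ (Matrix (Fin m) (Fin m) ℂ)) (hV : ∀ x : Fin n × Fin n → ℂ, N.map (MvPolynomial.eval x) ∈ V)
    (hnil : ∀ A ∈ V, IsNilpotent A)
    (hperm : ∀ a ∈ Algebra.adjoin ℂ (V : Set (Matrix (Fin m) (Fin m) ℂ)), ∀ c ∈ Algebra.adjoin ℂ (V : Set (Matrix (Fin m) (Fin m) ℂ)),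
      ∀ u ∈ Algebra.adjoin ℂ (V : Set (Matrix (Fin m) (Fin m) ℂ)), Matrix.trace (a * c * u) = Matrix.trace (c * a * u)) :
    n * (n - 1) ≤ 2 * (Nat.sqrt n * m) :=
  le_of_relCert_of_perPoly_eq_trace N M hM hper (relCert_of_valueSpace_trace_permutable N hN V hV hnil hperm)

/-- ★ **PERMUTABLE-TRACE RUNG, `(q, k)`-family form** (any exponent `d`): `per_n = tr(N^d·M)`, values of `N` in a nil space with generator
commutators trace-orthogonal to the envelope ⇒ `n² ≤ 2kn + m·q` for all `q ≥ 1`, `m ≤ kq` — the rung `m ≳ n^{3/2}/(2√2)` of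
✓ `DualUnipotentEngelRung.sq_le_of_trace_pow_mul_valueSpace_conj`. [cite: RadjaviRosenthal2000, Thm. 2.2.1] -/
theorem sq_le_of_trace_pow_mul_commutator_traceOrth {d q k : ℕ}
    (N M : Matrix (Fin m) (Fin m) (MvPolynomial (Fin n × Fin n) ℂ))
    (hN : ∀ i j, (N i j).totalDegree ≤ 1) (hM : ∀ i j, (M i j).totalDegree ≤ 1)
    (V : Submodule ℂ (Matrix (Fin m) (Fin m) ℂ)) (hV : ∀ x : Fin n × Fin n → ℂ, N.map (MvPolynomial.eval x) ∈ V)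
    (hnil : ∀ A ∈ V, IsNilpotent A)
    (h : ∀ A ∈ V, ∀ B ∈ V, ∀ u ∈ Algebra.adjoin ℂ (V : Set (Matrix (Fin m) (Fin m) ℂ)), Matrix.trace ((A * B - B * A) * u) = 0)
    (hper : perPoly (Fin n) ℂ = (N ^ d * M).trace) (hq : 1 ≤ q) (hmk : m ≤ k * q) :
    n ^ 2 ≤ k * (2 * n) + m * q := by
  obtain ⟨u, hu⟩ := (conj_strictUpper_iff_commutator_traceOrth V).2 ⟨hnil, h⟩
  exact sq_le_of_trace_pow_mul_valueSpace_conj N M hN hM V hV u hu hper hq hmk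

end Summit.ValiantsHypothesis.ValiantsHypothesis.Theorems.GrenetZeon.TraceTriangularisable

end
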